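import Summits.ResolutionOfSingularities.ResolutionOfSingularities.Theorems.FrobeniusClosingSteerChartRsopPart
import Summits.ResolutionOfSingularities.ResolutionOfSingularities.Theorems.FrobeniusClosingSteerToricVertexSplit
import HarnessLib

/-!
# Crux `Steer` (stmt-ResolutionOfSingularities-16345) — K-TX, part 1: the RING-LEVEL PAIR BLOW-UP along a valuation, with the
# regular-system-of-parameters bookkeeping («K-TX frame»)

OURS (campaign res-hironaka, rung L ★L-G4, slot W4.1; res-D-brk-2 g6 on res-L0-w41-plan-1 RULING 257 (a)(2) — object K-TX = the toric
stub `stub_unit_linear_tower` of res-L0-w41-strat-1's `KTX_skeleton-strat1-g10.lean` f14dbc5d71d79534, retyped per RULING 258 (c)).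
Candidates, not facts; NOT a statement of H. Hironaka's manuscript [claim: Hironaka2017, status: under-review]; AI formalisation, weaker than
expert review; `--supports stmt-ResolutionOfSingularities-16345`, counted 0.

## What is proved

A **K-TX frame** `Frame O R z` (`§1`) packages a REGULAR local subring `R ⊆ O` which is its own local ring at the centre of `O`
(`locAtCentre R O = R`), dominated by `O` (`a ∈ 𝔪_R ↔ v(a) < 1`), together with letters `z : Fin n → K` in `R ∖ 0` such that the
NON-UNIT letters are DISTINCT MEMBERS OF ONE REGULAR SYSTEM OF PARAMETERS of `R` (a minimal basis `x : Fin d → R` of `𝔪_R` and a position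
map `pos`, injective on the non-unit letters, with `x (pos j) = z j`).

* `frame_of_rsop` (`§1`) — the frame of K-TX's starting stage: `y` a regular system of parameters of a regular local `R ⊆ O` dominated by
  `O` (`Ideal.span (range y) = 𝔪`, `ringKrullDim R = n`).
* `frame_step_unit` (`§2`) — pivot letter `z_a` a UNIT: `z'_b = z_b / z_a`, the ring does not move (`IsLocalBlowup O R R`), the frame
  persists (`Associated` members generate the same ideal).
Part 1b (`…SteerToricUnitExitStep`) adds the NON-UNIT pivot (the genuine local blowing up along `(z_a, z_b)`, de Jong 2.4) and the
dichotomy decided by the valuation.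
[cite: DeJong1996, 2.4] [cite: NovacoskiSpivakovsky2014, Def. 2.8, Def. 2.11] [cite: Matsumura1987, Thm. 14.2] [folklore]
-/

noncomputable section

-- single-problem summit: the doubled namespace component `ResolutionOfSingularities` is forced
set_option linter.dupNamespace false

open scoped BigOperators

namespace Summit.ResolutionOfSingularities.ResolutionOfSingularities.Theorems.SteerToricUnitExit

open IsLocalRing
open Literature.AlgebraicGeometry.Resolution
open Summit.ResolutionOfSingularities.ResolutionOfSingularities.Theorems.SwitchingDichotomy
open Summit.ResolutionOfSingularities.ResolutionOfSingularities.Theorems.SteerToricVertexSplit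

variable {K : Type} [Field K]

/-! ## §1 The K-TX frame -/

section Frame

variable {n : ℕ}

/-- **K-TX frame** of a stage: `R ⊆ O` a REGULAR local subring equal to its local ring at the centre of `O` and dominated by `O`; letters
`z : Fin n → K` in `R ∖ 0`; and a minimal basis `x` of `𝔪_R` with a position map `pos` such that every NON-UNIT letter `z_j` IS the basis
member `x (pos j)`, `pos` injective on the non-unit letters («the non-unit letters are distinct members of one regular system of parameters»).
OURS bookkeeping. [cite: Matsumura1987, Thm. 14.2] [folklore] -/
def Frame (O : ValuationSubring K) (R : Subring K) (z : Fin n → K) : Prop :=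
  ∃ (_ : IsRegularLocalRing R), R ≤ O.toSubring ∧ locAtCentre R O = R ∧
    (∀ a : R, a ∈ maximalIdeal R ↔ O.valuation (a : K) < 1) ∧ (∀ j, z j ≠ 0) ∧
    ∃ (_ : ∀ j, z j ∈ R) (d : ℕ) (x : Fin d → R) (pos : Fin n → Fin d),
      Ideal.span (Set.range x) = maximalIdeal R ∧ (maximalIdeal R).spanFinrank = d ∧
      (∀ j, O.valuation (z j) < 1 → ((x (pos j) : R) : K) = z j) ∧
      (∀ j j', O.valuation (z j) < 1 → O.valuation (z j') < 1 → pos j = pos j' → j = j')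

/-- A local subring dominated by `O` is its own local ring at the centre of `O`. [cite: NovacoskiSpivakovsky2014, Def. 2.8] -/
theorem locAtCentre_eq_self_of_dominated (O : ValuationSubring K) (R : Subring K) [IsLocalRing R]
    (hcen : ∀ a : R, a ∈ maximalIdeal R ↔ O.valuation (a : K) < 1) : locAtCentre R O = R := by
  refine le_antisymm ?_ (le_locAtCentre R O)
  rintro _ ⟨y, hy, s, hs, hv, rfl⟩
  have hunit : IsUnit (⟨s, hs⟩ : R) := by
    by_contra hnu
    have hmem : (⟨s, hs⟩ : R) ∈ maximalIdeal R := (IsLocalRing.mem_maximalIdeal _).mpr hnu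
    have hlt := (hcen _).mp hmem
    exact absurd hv (ne_of_lt hlt)
  obtain ⟨w, hw⟩ := hunit
  have hinv : s⁻¹ = ((↑w⁻¹ : R) : K) := by
    have h1 : ((w : R) : K) * ((↑w⁻¹ : R) : K) = 1 := by
      rw [← Subring.coe_mul, Units.mul_inv, Subring.coe_one]
    rw [hw] at h1
    exact (eq_inv_of_mul_eq_one_right h1).symm
  rw [div_eq_mul_inv, hinv]
  exact R.mul_mem hy (↑w⁻¹ : R).2

/-- **The frame of K-TX's starting stage**: a regular system of parameters `y` of a regular local `R ⊆ O` dominated by `O` gives the frame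
of the letters `y`. OURS. [cite: Matsumura1987, Thm. 14.2] -/
theorem frame_of_rsop (O : ValuationSubring K) (R : Subring K) (hreg : IsRegularLocalRing R) (hRO : R ≤ O.toSubring)
    (hcen : ∀ a : R, a ∈ maximalIdeal R ↔ O.valuation (a : K) < 1)
    (y : Fin n → R) (hy : Ideal.span (Set.range y) = maximalIdeal R) (hn : ringKrullDim R = n) :
    Frame O R (fun j => (y j : K)) := by
  have hd : (maximalIdeal R).spanFinrank = n := by
    have h := IsRegularLocalRing.spanFinrank_maximalIdeal (R := R)
    rw [hn] at h
    exact_mod_cast h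
  have hrsop : IsRsopPart y := ⟨hreg, 0, Fin.elim0, by rw [hn]; rfl, by
    rw [← hy]; congr 1; ext a; simp⟩
  refine ⟨hreg, hRO, locAtCentre_eq_self_of_dominated O R hcen, hcen, fun j h => hrsop.ne_zero j (Subtype.ext h),
    fun j => (y j).2, n, y, id, hy, hd, fun j _ => rfl, fun j j' _ _ h => h⟩

/-- In a frame every non-unit letter is a member of a regular system of parameters, hence NOT in `𝔪²` — the K-TX exit condition of
case A. [cite: Matsumura1987, Thm. 14.2] -/
theorem Frame.not_mem_sq {O : ValuationSubring K} {R : Subring K} {z : Fin n → K} (hF : Frame O R z) (j : Fin n)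
    (hj : O.valuation (z j) < 1) :
    ∃ (_ : IsRegularLocalRing R) (hzj : z j ∈ R), (⟨z j, hzj⟩ : R) ∉ maximalIdeal R ^ 2 := by
  obtain ⟨hreg, -, -, -, -, hz, d, x, pos, hxspan, hxd, hxz, -⟩ := hF
  refine ⟨hreg, hz j, ?_⟩
  have hpart : IsRsopPart (x ∘ fun _ : Fin 1 => pos j) :=
    isRsopPart_comp_of_rsop hxd x hxspan _ fun a b _ => Subsingleton.elim a b
  have h := hpart.not_mem_sq 0
  have e : (x ∘ fun _ : Fin 1 => pos j) 0 = ⟨z j, hz j⟩ := Subtype.ext (hxz j hj)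
  rwa [e] at h

end Frame

/-! ## §2 The step with a UNIT pivot: the ring does not move -/

section UnitStep

variable {n : ℕ}

/-- **Unit pivot.** If `z_a` is a unit of `O` then `z'_b := z_b / z_a` lies in `R` already: the «blow-up» is the identity local blowing up
`IsLocalBlowup O R R` and the frame persists for `update z b (z_b / z_a)` (the basis member at `pos b` is replaced by an associate).
OURS. [folklore] -/
theorem frame_step_unit (O : ValuationSubring K) (R : Subring K) (z : Fin n → K) (hF : Frame O R z) {a b : Fin n} (hab : a ≠ b)
    (hva : ¬ O.valuation (z a) < 1) :
    IsLocalBlowup O R R ∧ Frame O R (Function.update z b (z b / z a)) := by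
  classical
  obtain ⟨hreg, hRO, hRloc, hcen, hz0, hz, d, x, pos, hxspan, hxd, hxz, hinj⟩ := hF
  have hva1 : O.valuation (z a) = 1 := le_antisymm ((O.valuation_le_one_iff _).mpr (hRO (hz a))) (not_lt.mp hva)
  -- `z_a` is a unit of `R`
  have hunit : IsUnit (⟨z a, hz a⟩ : R) := by
    by_contra hnu
    exact hva ((hcen _).mp ((IsLocalRing.mem_maximalIdeal _).mpr hnu))
  obtain ⟨w, hw⟩ := hunit
  have hwinv : ((↑w⁻¹ : R) : K) = (z a)⁻¹ := by
    have h1 : ((w : R) : K) * ((↑w⁻¹ : R) : K) = 1 := by rw [← Subring.coe_mul, Units.mul_inv, Subring.coe_one]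
    rw [hw] at h1
    exact eq_inv_of_mul_eq_one_right h1
  have hqR : z b / z a ∈ R := by
    rw [div_eq_mul_inv, ← hwinv]; exact R.mul_mem (hz b) (↑w⁻¹ : R).2
  refine ⟨⟨hRO, ∅, by simp, by rw [Finset.coe_empty, Set.union_empty, Subring.closure_eq, hRloc]⟩, ?_⟩
  have hz' : ∀ j, Function.update z b (z b / z a) j ∈ R := fun j => by
    by_cases h : j = b
    · subst h; rw [Function.update_self]; exact hqR
    · rw [Function.update_of_ne h]; exact hz j
  have hvq : O.valuation (z b / z a) = O.valuation (z b) := by rw [map_div₀, hva1, div_one]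
  -- the new basis: replace `x (pos b)` by the associate `x (pos b) · w⁻¹` when `z_b` is a non-unit
  by_cases hvb : O.valuation (z b) < 1
  · set x' : Fin d → R := Function.update x (pos b) (x (pos b) * ↑w⁻¹) with hx'
    have hassoc : ∀ i, Associated (x i) (x' i) := fun i => by
      by_cases h : i = pos b
      · subst h; rw [hx', Function.update_self]; exact ⟨w⁻¹, rfl⟩
      · rw [hx', Function.update_of_ne h]
    have hx'span : Ideal.span (Set.range x') = maximalIdeal R := by
      rw [← Ideal.span_range_eq_of_associated hassoc, hxspan]
    refine ⟨hreg, hRO, hRloc, hcen, update_div_ne_zero z hz0 a b, hz', d, x', pos, hx'span, hxd, fun j hj => ?_, fun j j' hj hj' h => ?_⟩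
    · by_cases h : j = b
      · subst h
        rw [Function.update_self, hx', Function.update_self, Subring.coe_mul, hxz j hvb, hwinv, div_eq_mul_inv]
      · have hj' : O.valuation (z j) < 1 := by rwa [Function.update_of_ne h] at hj
        have hne : pos j ≠ pos b := fun e => h (hinj j b hj' hvb e)
        rw [Function.update_of_ne h, hx', Function.update_of_ne hne, hxz j hj']
    · have e1 : ∀ i, O.valuation (Function.update z b (z b / z a) i) < 1 → O.valuation (z i) < 1 := fun i hi => by
        by_cases h : i = b
        · subst h; exact hvb
        · rwa [Function.update_of_ne h] at hi
      exact hinj j j' (e1 j hj) (e1 j' hj') h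
  · refine ⟨hreg, hRO, hRloc, hcen, update_div_ne_zero z hz0 a b, hz', d, x, pos, hxspan, hxd, fun j hj => ?_, fun j j' hj hj' h => ?_⟩
    · have h : j ≠ b := by rintro rfl; rw [Function.update_self, hvq] at hj; exact hvb hj
      have hj' : O.valuation (z j) < 1 := by rwa [Function.update_of_ne h] at hj
      rw [Function.update_of_ne h, hxz j hj']
    · have e1 : ∀ i, O.valuation (Function.update z b (z b / z a) i) < 1 → i ≠ b ∧ O.valuation (z i) < 1 := fun i hi => by
        by_cases h : i = b
        · subst h; rw [Function.update_self, hvq] at hi; exact absurd hi hvb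
        · exact ⟨h, by rwa [Function.update_of_ne h] at hi⟩
      exact hinj j j' (e1 j hj).2 (e1 j' hj').2 h

end UnitStep

end Summit.ResolutionOfSingularities.ResolutionOfSingularities.Theorems.SteerToricUnitExit

end
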